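import Literature.NumberTheory.GaloisRepresentations.ArtinRepresentationProofs
import Literature.NumberTheory.GaloisRepresentations.ArtinRepresentationDifferentProofs
import Literature.NumberTheory.GaloisRepresentations.ArtinConductorHerbrandProofs
import Literature.NumberTheory.GaloisRepresentations.RamificationFiltrationTowerProofs
import Literature.NumberTheory.GaloisRepresentations.RamificationFiltrationHerbrandProofs
import Literature.NumberTheory.GaloisRepresentations.RamificationFiltrationHerbrandInverseProofs
import Literature.NumberTheory.GaloisRepresentations.RamificationFiltrationHerbrandPsiProofs
import Literature.NumberTheory.GaloisRepresentations.RamificationGalois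
import Literature.RepresentationTheory.FiniteGroups.MonomialCharacters
import HarnessLib

/-!
# Integrality of `f(χ)` for characters of degree one from the Hasse–Arf theorem (Serre VI §2, Cor. to Prop. 5), and the Artin–Katz integrality statement from Hasse–Arf

`ArtinRepresentation.lean` vendors, as the named fact
`Literature.card_inf_inertia_dvd_finsum_card_inf_ramificationSubgroup R` (Serre, *Local Fields*, Ch. VI
§2, Prop. 5 and its Corollary, numerator form), the second arithmetic input of Artin's proof of
the integrality of the conductor: for `R` Dedekind with fraction field `K`, `L/K` finite Galois
with group `G`, a maximal ideal `𝔓` of `S_L = integralClosure R L` with separable residue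
extension, a subgroup `H ≤ G` and a character `θ : H → ℂˣ` of degree one,
**`|H ∩ G_0|` divides `Σ_{i : θ(H ∩ G_i) ≠ 1} |H ∩ G_i|`** — i.e. `f(θ) = φ_{L/L^H}(c_θ) + 1` is an
integer.  Serre: "by Herbrand's theorem and the Hasse–Arf theorem, since `H/ker θ` is abelian".
This file carries out that deduction, reducing the fact to the **Hasse–Arf theorem** as vendored
(`Literature.NumberTheory.GaloisRepresentations.hasseArf`: the jumps of the upper numbering of an abelian Galois group are integers):

* `Literature.NumberTheory.GaloisRepresentations.card_inf_inertia_dvd_finsum_card_inf_ramificationSubgroup_of_hasseArf` — the reduction.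
  Proof.  The indices `i` with `θ(H_i) ≠ 1`, `H_i = H ∩ G_i`, form an initial segment `[0, c]`
  (or are absent, when the sum vanishes), so the sum is `Σ_{i ≤ c} |H_i|`.  Change the base to
  `F = L^H`: `R' = S_F` (Dedekind, fraction field `F`), `G' = Gal(L/F) ≅ H` (restriction of
  scalars), `S' = integralClosure R' L`, identified with `S_L` by the identity on elements (an
  `R'`-integral element of `L` is `R`-integral and conversely), equivariantly; the ramification
  groups of `𝔓' = 𝔓` in `G'` are the `H ∩ G_i` (Ch. IV §1 Prop. 2, by transport:
  `RamificationFiltrationTowerProofs.ramificationSubgroup_comap_ringEquiv`), so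
  `φ' = φ_{L/F}` has `|G'_0| φ'(c) = Σ_{i=1}^{c} |H ∩ G_i|` (`herbrandPhi_natCast`), and the residue
  extension of `𝔓'` over `𝔓' ∩ R'` is separable (it is a subextension of that of `𝔓` over `𝔓 ∩ R`).
  Let `θ' = θ|_{G'}`, `N = ker θ'` and `E = L^N`, Galois over `F` with group `G'/N ↪ ℂˣ`, abelian.
  By Herbrand's theorem for `L/E/F` at `𝔓'` (`herbrand_quotient_holds`, Ch. IV §3 Prop. 14) the
  upper filtration of `Gal(E/F)` is the image of that of `G'`; with `ψ' ∘ φ' = id`,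
  `φ' ∘ ψ' = id` and `ψ'` monotone (`RamificationFiltrationHerbrand*Proofs`) one gets
  `Gal(E/F)^{φ'(c)} = G'_c N/N ≠ 1` (`θ' ≠ 1` on `G'_c`) and `Gal(E/F)^w ⊆ G'_{c+1} N/N = 1` for
  `w > φ'(c)` (`θ' = 1` on `G'_{c+1}`): `v = φ'(c)` is a jump, hence an integer `n` by Hasse–Arf
  for `E/F` at `𝔓' ∩ E` (Ch. IV §3; this is Serre's "`φ_{L/K}(c_χ) = φ_{L'/K}(c'_χ)` is an
  integer"), and `Σ_{i ≤ c} |H ∩ G_i| = (n + 1) |H ∩ G_0|`.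
* `Literature.NumberTheory.GaloisRepresentations.exists_natCast_eq_artinExponent_of_hasseArf`,
  `Literature.NumberTheory.GaloisRepresentations.GaloisRep.exists_natCast_eq_artinConductorAt_of_hasOpenInertiaKerAt_of_hasseArf` (and
  `…_charZero`) — **end-to-end**: with Herbrand's theorem (`ArtinConductorHerbrandProofs`), the
  integrality of the different exponent (`ArtinRepresentationDifferentProofs`) and the present
  reduction, Artin's theorem `f(τ) ∈ ℕ` for representations of the inertia group at a prime of a
  number field, and the corrected Artin–Katz integrality statement
  `Literature.NumberTheory.GaloisRepresentations.GaloisRep.exists_natCast_eq_artinConductorAt_of_hasOpenInertiaKerAt` (`ArtinConductor.lean`),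
  follow from exactly: the Hasse–Arf theorem (`Literature.NumberTheory.GaloisRepresentations.hasseArf`, for the finite layers of `K̄` and
  their subfields), and — only for coefficient fields of positive characteristic — Artin's
  theorem over finite fields (`Literature.NumberTheory.GaloisRepresentations.exists_natCast_eq_artinExponent_finiteField`, Katz 1.9 / Serre
  *LinRep* 19.3); Brauer's induction theorem is taken from its proof in the tree
  (`Literature.RepresentationTheory.FiniteGroups.brauer_induction_holds`, `RepresentationTheory/FiniteGroups/MonomialCharacters`).

## Implementation notes

Theorems only.  The base change uses nested integral closures `integralClosure (integralClosure R F) L`;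
for these the generic subalgebra instances make searches such as `SMul (integralClosure R F) _`
time out, so the proof names the intended instances (`Subalgebra.algebra`, `Subalgebra.algebra'`,
the quotient algebras of `Ideal.Quotient`) with `letI`, and does *not* register the local
instances of `RamificationGalois.lean` (it applies `integralClosureAlgebra`,
`isSeparable_residue_bot`, … as terms).  The Hasse–Arf hypothesis is quantified over all
`(R', K', L')` in the universe of `L`, as a universe-polymorphic discharge `hasseArf_holds` would
provide it; it is used at `(S_F, F, E)`.

## References

* J.-P. Serre, *Local Fields*, GTM 67, Springer 1979: Ch. IV §1 Prop. 2 (`H_i = G_i ∩ H`), §3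
  Prop. 14–15, Lemma 5 and the Theorem of Hasse–Arf (p. 76); Ch. V §7; Ch. VI §2, Prop. 5 and its
  Corollary (p. 102), proof of Thms 1 and 1' (p. 103). [SerreLocalFields1979]
* N. M. Katz, *Gauss Sums, Kloosterman Sums, and Monodromy Groups*, Princeton 1988, Ch. 1,
  Prop. 1.9. [Katz1988]
* J. Neukirch, *Algebraic Number Theory*, Springer 1999, Ch. II §10, Ch. V (1.7)–(1.9)
  (Hasse–Arf via class field theory). [NeukirchANT1999]
-/

noncomputable section

open scoped Pointwise

namespace Literature.NumberTheory.GaloisRepresentations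

universe u v w

/-! ### Pull-back of the ramification filtration along an injective equivariant map -/

section Transport

variable {S₁ S₂ : Type*} [CommRing S₁] [CommRing S₂] {G₁ G₂ : Type*} [Group G₁] [Group G₂]
  [MulSemiringAction G₁ S₁] [MulSemiringAction G₂ S₂]
  (e : S₁ ≃+* S₂) (f : G₁ →* G₂) (hef : ∀ (g : G₁) (x : S₁), e (g • x) = f g • e x)

include hef in
/-- Along an equivariant ring isomorphism `e : S₁ ≃ S₂` with *injective* `f : G₁ → G₂`:
`#G_i(e⁻¹𝔓) = #(f(G₁) ∩ G_i(𝔓))` (Serre IV §1 Prop. 2, `H_i = G_i ∩ H`, transported).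
Ref: Serre, *Local Fields*, Ch. IV §1, Prop. 2. [cite: SerreLocalFields1979, Ch. IV §1 Prop. 2] -/
theorem card_ramificationSubgroup_comap_eq_card_range_inf (hf : Function.Injective f)
    (𝔓 : Ideal S₂) (i : ℕ) :
    Nat.card ((𝔓.comap e).ramificationSubgroup G₁ i) =
      Nat.card ↥(f.range ⊓ 𝔓.ramificationSubgroup G₂ i) := by
  rw [ramificationSubgroup_comap_ringEquiv e f hef, ← Subgroup.map_comap_eq,
    Subgroup.card_map_of_injective hf]

end Transport

/-! ### The reduction -/

section Main

set_option maxHeartbeats 1600000 in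
/-- **`|H ∩ G_0|` divides `Σ_{i : θ(H ∩ G_i) ≠ 1} |H ∩ G_i|`, from the Hasse–Arf theorem** (Serre,
Ch. VI §2, Prop. 5 and Corollary: `f(χ) = φ_{L/K}(c_χ) + 1`, "and this is an integer `≥ 0`: by
Herbrand's theorem `φ_{L/K}(c_χ) = φ_{L'/K}(c'_χ)`, `L' = L^{ker χ}`, which is an integer by
Hasse–Arf since `G/H` is abelian"), i.e. the named fact
`Literature.card_inf_inertia_dvd_finsum_card_inf_ramificationSubgroup R` for `L/K`, granted `Literature.NumberTheory.GaloisRepresentations.hasseArf`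
for all finite Galois extensions of Dedekind fraction fields in the universe of `L` (it is used for
`E/F`, `F = L^H`, `E = L^{ker θ}`, over `S_F`).  Proof: see the module docstring (last jump `c` of
`θ` on the `H ∩ G_i`; base change to `F = L^H` and transport of the ramification groups; Herbrand's
theorem for `L/E/F`; `φ_{L/F}(c)` is a jump of the upper filtration of the abelian group
`Gal(E/F)`, hence an integer `n`; `Σ_{i ≤ c} |H ∩ G_i| = (n+1)|H ∩ G_0|`).
Ref: Serre, *Local Fields*, Ch. VI §2, Prop. 5 and Corollary (p. 102); Ch. IV §3, Prop. 14,
Prop. 15, Lemma 5, Theorem (Hasse–Arf); Ch. IV §1, Prop. 2.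
[cite: SerreLocalFields1979, Ch. VI §2, Prop. 5 and its Corollary]
[cite: SerreLocalFields1979, Ch. IV §3, Theorem (Hasse–Arf)] -/
theorem card_inf_inertia_dvd_finsum_card_inf_ramificationSubgroup_of_hasseArf
    {R : Type u} {K : Type v} {L : Type w} [CommRing R] [Field K] [Field L] [Algebra R K]
    [Algebra R L] [Algebra K L] [IsScalarTower R K L]
    (hHA : ∀ (R' K' L' : Type w) [CommRing R'] [Field K'] [Field L'] [Algebra R' K']
      [Algebra R' L'] [Algebra K' L'] [IsScalarTower R' K' L'], hasseArf R' (K := K') (L := L')) :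
    card_inf_inertia_dvd_finsum_card_inf_ramificationSubgroup R (K := K) (L := L) := by
  intro _ _ _ _ 𝔓 _ hsep H θ
  classical
  haveI : IsDedekindDomain (integralClosure R L) := integralClosure.isDedekindDomain R K L
  haveI : FaithfulSMul (L ≃ₐ[K] L) (integralClosure R L) := faithfulSMul_algEquiv_integralClosure R
  obtain ⟨Nb, hNb⟩ := Ideal.ramificationSubgroup_eventually_eq_bot_holds 𝔓 (L ≃ₐ[K] L)
    (Ideal.IsMaximal.ne_top inferInstance)
  ------------------------------------------------------------------
  -- Step 1: the sum is `Σ_{i ≤ c} |H ∩ G_i|` for the last index `c` at which `θ|_{H ∩ G_c} ≠ 1`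
  ------------------------------------------------------------------
  set cond : ℕ → Prop := fun i =>
    ¬ (H ⊓ 𝔓.ramificationSubgroup (L ≃ₐ[K] L) i).subgroupOf H ≤ θ.ker with hcond
  have hanti : ∀ {i j : ℕ}, i ≤ j → cond j → cond i := by
    intro i j hij hj hi
    refine hj fun x hx => hi ?_
    rw [Subgroup.mem_subgroupOf] at hx ⊢
    exact ⟨hx.1, 𝔓.ramificationSubgroup_antitone (L ≃ₐ[K] L) hij hx.2⟩
  have hNb' : ∀ i, Nb ≤ i → ¬ cond i := fun i hi h => h fun x hx => by
    rw [Subgroup.mem_subgroupOf, hNb i hi, Subgroup.mem_inf, Subgroup.mem_bot] at hx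
    rw [MonoidHom.mem_ker, show x = 1 from Subtype.ext hx.2, map_one]
  have hsupp : (Function.support fun i : ℕ =>
      if (H ⊓ 𝔓.ramificationSubgroup (L ≃ₐ[K] L) i).subgroupOf H ≤ θ.ker then 0
      else Nat.card ↥(H ⊓ 𝔓.ramificationSubgroup (L ≃ₐ[K] L) i)) ⊆ Finset.range Nb := by
    intro i hi
    rw [Function.mem_support] at hi
    rw [Finset.coe_range, Set.mem_Iio]
    by_contra h
    exact hi (if_pos (not_not.mp (hNb' i (not_lt.mp h))))
  rw [finsum_eq_sum_of_support_subset _ hsupp]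
  by_cases h0 : cond 0
  swap
  · rw [Finset.sum_eq_zero fun i _ => if_pos (not_not.mp fun h => h0 (hanti (Nat.zero_le i) h))]
    exact dvd_zero _
  obtain ⟨c, hc, hcmax⟩ : ∃ c, cond c ∧ ∀ j, cond j → j ≤ c := by
    refine ⟨Nat.findGreatest cond Nb, Nat.findGreatest_spec (Nat.zero_le Nb) h0, fun j hj =>
      Nat.le_findGreatest (le_of_lt (not_le.mp fun h => hNb' j h hj)) hj⟩
  have hc1 : ¬ cond (c + 1) := fun h => Nat.not_succ_le_self c (hcmax _ h)
  have hcN : c + 1 ≤ Nb := not_lt.mp fun h => hNb' c (by omega) hc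
  have hsum : (∑ i ∈ Finset.range Nb,
      if (H ⊓ 𝔓.ramificationSubgroup (L ≃ₐ[K] L) i).subgroupOf H ≤ θ.ker then 0
      else Nat.card ↥(H ⊓ 𝔓.ramificationSubgroup (L ≃ₐ[K] L) i)) =
        ∑ i ∈ Finset.range (c + 1), Nat.card ↥(H ⊓ 𝔓.ramificationSubgroup (L ≃ₐ[K] L) i) := by
    rw [← Finset.sum_range_add_sum_Ico _ hcN,
      Finset.sum_eq_zero (s := Finset.Ico (c + 1) Nb) fun i hi => if_pos (not_not.mp fun h =>
        Nat.not_succ_le_self c ((Finset.mem_Ico.mp hi).1.trans (hcmax i h))), add_zero]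
    exact Finset.sum_congr rfl fun i hi =>
      if_neg (hanti (Nat.lt_succ_iff.mp (Finset.mem_range.mp hi)) hc)
  rw [hsum]
  ------------------------------------------------------------------
  -- Step 2: base change to `F = L^H`: `R' = S_F`, `G' = Gal(L/F) ≅ H`, `S' = integralClosure R' L`
  ------------------------------------------------------------------
  set F : IntermediateField K L := IntermediateField.fixedField H with hF
  have hHF : F.fixingSubgroup = H := IntermediateField.fixingSubgroup_fixedField H
  haveI : IsDedekindDomain (integralClosure R F) := integralClosure.isDedekindDomain R K F
  haveI : IsFractionRing (integralClosure R F) F :=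
    integralClosure.isFractionRing_of_finite_extension K F
  let ι : (L ≃ₐ[F] L) →* (L ≃ₐ[K] L) := AlgEquiv.restrictScalarsHom K
  have hιapp : ∀ (σ : L ≃ₐ[F] L) (x : L), ι σ x = σ x := fun σ x => rfl
  have hιinj : Function.Injective ι := fun σ τ h => AlgEquiv.ext fun x => by
    rw [← hιapp, h, hιapp]
  have hιrange : ι.range = H := by
    ext τ
    constructor
    · rintro ⟨σ, rfl⟩
      rw [← hHF, IntermediateField.mem_fixingSubgroup_iff]
      intro x hx
      rw [hιapp]
      exact σ.commutes ⟨x, hx⟩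
    · intro hτ
      rw [← hHF, IntermediateField.mem_fixingSubgroup_iff] at hτ
      exact ⟨{ τ with commutes' := fun x => hτ x x.2 }, AlgEquiv.ext fun x => rfl⟩
  haveI : IsScalarTower R (integralClosure R F) L := IsScalarTower.of_algebraMap_eq fun _ => rfl
  have hint : ∀ x : L, IsIntegral (integralClosure R F) x ↔ IsIntegral R x := fun x =>
    ⟨fun h => isIntegral_trans x h, fun h => h.tower_top⟩
  let e : integralClosure (integralClosure R F) L ≃+* integralClosure R L :=
    { toFun := fun x => ⟨x, (hint x).mp x.2⟩
      invFun := fun x => ⟨x, (hint x).mpr x.2⟩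
      left_inv := fun x => rfl
      right_inv := fun x => rfl
      map_mul' := fun x y => rfl
      map_add' := fun x y => rfl }
  have hef : ∀ (σ : L ≃ₐ[F] L) (x : integralClosure (integralClosure R F) L),
      e (σ • x) = ι σ • e x := fun σ x => rfl
  set 𝔓' : Ideal (integralClosure (integralClosure R F) L) := 𝔓.comap e with h𝔓'
  haveI : 𝔓'.IsMaximal := Ideal.comap_isMaximal_of_surjective _ e.surjective
  have hcard : ∀ i, Nat.card (𝔓'.ramificationSubgroup (L ≃ₐ[F] L) i) =
      Nat.card ↥(H ⊓ 𝔓.ramificationSubgroup (L ≃ₐ[K] L) i) := fun i => by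
    rw [h𝔓', card_ramificationSubgroup_comap_eq_card_range_inf e ι hef hιinj, hιrange]
  have hmemi : ∀ (i : ℕ) (σ : L ≃ₐ[F] L), σ ∈ 𝔓'.ramificationSubgroup (L ≃ₐ[F] L) i ↔
      ι σ ∈ 𝔓.ramificationSubgroup (L ≃ₐ[K] L) i := fun i σ => by
    rw [h𝔓', ramificationSubgroup_comap_ringEquiv e ι hef 𝔓 i, Subgroup.mem_comap]
  -- residue separability at `𝔓'` over `𝔓' ∩ R'` (from that at `𝔓` over `𝔓 ∩ R`)
  -- (shortcut instances: `R' = S_F` is a subalgebra, and generic instance search for `SMul R' _`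
  -- wanders through actions of `F` and `L`)
  letI algR'S' : Algebra (integralClosure R F) (integralClosure (integralClosure R F) L) :=
    (integralClosure (integralClosure R F) L).algebra
  letI smulR'S' : SMul (integralClosure R F) (integralClosure (integralClosure R F) L) :=
    algR'S'.toSMul
  letI modR'S' : Module (integralClosure R F) (integralClosure (integralClosure R F) L) :=
    algR'S'.toModule
  letI algRS' : Algebra R (integralClosure (integralClosure R F) L) :=
    (integralClosure (integralClosure R F) L).algebra'
  letI smulRS' : SMul R (integralClosure (integralClosure R F) L) := algRS'.toSMul
  haveI : IsScalarTower R (integralClosure R F) (integralClosure (integralClosure R F) L) :=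
    IsScalarTower.of_algebraMap_eq fun _ => rfl
  have h𝔭 : 𝔓'.under R = 𝔓.under R := by
    ext r
    simp only [Ideal.under_def, Ideal.mem_comap, h𝔓']
    exact Iff.rfl
  haveI h𝔭max : (𝔓.under R).IsMaximal := Ideal.IsMaximal.under R 𝔓
  haveI h𝔭'max : (𝔓'.under R).IsMaximal := by rw [h𝔭]; exact h𝔭max
  haveI : Algebra.IsIntegral (integralClosure R F) (integralClosure (integralClosure R F) L) :=
    integralClosure.AlgebraIsIntegral
  haveI hsepR : Algebra.IsSeparable (R ⧸ 𝔓'.under R)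
      (integralClosure (integralClosure R F) L ⧸ 𝔓') := by
    letI : Field (R ⧸ 𝔓.under R) := Ideal.Quotient.field _
    letI : Field (R ⧸ 𝔓'.under R) := Ideal.Quotient.field _
    refine Algebra.IsSeparable.of_equiv_equiv (A₁ := R ⧸ 𝔓.under R)
      (B₁ := integralClosure R L ⧸ 𝔓) (A₂ := R ⧸ 𝔓'.under R)
      (B₂ := integralClosure (integralClosure R F) L ⧸ 𝔓') (Ideal.quotEquivOfEq h𝔭.symm)
      (Ideal.quotientEquiv 𝔓 𝔓' e.symm (by rw [Ideal.map_comap_of_equiv, RingEquiv.symm_symm])) ?_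
    refine Ideal.Quotient.ringHom_ext (RingHom.ext fun r => ?_)
    rfl
  haveI hsep' : Algebra.IsSeparable
      (integralClosure R F ⧸ 𝔓'.under (integralClosure R F))
      (integralClosure (integralClosure R F) L ⧸ 𝔓') := by
    haveI : (𝔓'.under (integralClosure R F)).IsMaximal := Ideal.IsMaximal.under _ 𝔓'
    letI : Field (integralClosure R F ⧸ 𝔓'.under (integralClosure R F)) := Ideal.Quotient.field _
    -- shortcut instances for the residue algebras (as in `RamificationGalois.lean`)
    letI algq₁ : Algebra (integralClosure R F ⧸ 𝔓'.under (integralClosure R F))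
        (integralClosure (integralClosure R F) L ⧸ 𝔓') := inferInstance
    letI smulq₁ : SMul (integralClosure R F ⧸ 𝔓'.under (integralClosure R F))
        (integralClosure (integralClosure R F) L ⧸ 𝔓') := algq₁.toSMul
    haveI : (𝔓'.under (integralClosure R F)).LiesOver (𝔓'.under R) :=
      ⟨(Ideal.under_under 𝔓').symm⟩
    letI algq₀ : Algebra (R ⧸ 𝔓'.under R) (integralClosure R F ⧸ 𝔓'.under (integralClosure R F)) :=
      Ideal.Quotient.algebraOfLiesOver _ _
    letI smulq₀ : SMul (R ⧸ 𝔓'.under R) (integralClosure R F ⧸ 𝔓'.under (integralClosure R F)) :=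
      algq₀.toSMul
    letI algq₂ : Algebra (R ⧸ 𝔓'.under R) (integralClosure (integralClosure R F) L ⧸ 𝔓') :=
      inferInstance
    letI smulq₂ : SMul (R ⧸ 𝔓'.under R) (integralClosure (integralClosure R F) L ⧸ 𝔓') :=
      algq₂.toSMul
    haveI : IsScalarTower (R ⧸ 𝔓'.under R) (integralClosure R F ⧸ 𝔓'.under (integralClosure R F))
        (integralClosure (integralClosure R F) L ⧸ 𝔓') :=
      IsScalarTower.of_algebraMap_eq fun r => by
        obtain ⟨r, rfl⟩ := Ideal.Quotient.mk_surjective r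
        rfl
    exact Algebra.isSeparable_tower_top_of_isSeparable (R ⧸ 𝔓'.under R)
      (integralClosure R F ⧸ 𝔓'.under (integralClosure R F))
      (integralClosure (integralClosure R F) L ⧸ 𝔓')
  ------------------------------------------------------------------
  -- Step 3: `θ' = θ ∘ ι`, the abelian extension `E = L^{ker θ'}` of `F`, Herbrand, Hasse–Arf
  ------------------------------------------------------------------
  have hιmem : ∀ σ, ι σ ∈ H := fun σ => hιrange ▸ ⟨σ, rfl⟩
  let θ' : (L ≃ₐ[F] L) →* ℂˣ := θ.comp (ι.codRestrict H hιmem)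
  have hθ' : ∀ σ, θ' σ = θ ⟨ι σ, hιmem σ⟩ := fun σ => rfl
  set E : IntermediateField F L := IntermediateField.fixedField θ'.ker with hE
  haveI : IsGalois F E := IsGalois.of_fixedField_normal_subgroup θ'.ker
  have hEfix : E.fixingSubgroup = θ'.ker := IntermediateField.fixingSubgroup_fixedField _
  have hab : ∀ a b : E ≃ₐ[F] E, a * b = b * a := by
    intro a b
    obtain ⟨σ, rfl⟩ := AlgEquiv.restrictNormalHom_surjective L a
    obtain ⟨τ, rfl⟩ := AlgEquiv.restrictNormalHom_surjective L b
    rw [← map_mul, ← map_mul, ← mul_inv_eq_one, ← map_inv, ← map_mul, ← MonoidHom.mem_ker,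
      IntermediateField.restrictNormalHom_ker, hEfix, MonoidHom.mem_ker, map_mul, map_inv,
      map_mul, map_mul, mul_comm (θ' τ) (θ' σ), mul_inv_cancel]
  -- Herbrand's theorem for `L/E/F` at `𝔓'`
  have hupper : ∀ v : ℝ,
      upperRamificationSubgroup (𝔓'.comap (E.integralClosureInclusion (integralClosure R F)))
        (E ≃ₐ[F] E) v =
      (upperRamificationSubgroup 𝔓' (L ≃ₐ[F] L) v).map (AlgEquiv.restrictNormalHom E) :=
    fun v => herbrand_quotient_holds (integralClosure R F) E 𝔓' v
  set v₀ : ℝ := herbrandPhi 𝔓' (L ≃ₐ[F] L) c with hv₀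
  have hψφ : herbrandPsi 𝔓' (L ≃ₐ[F] L) v₀ = c := herbrandPsi_herbrandPhi_holds 𝔓' _ (c : ℝ)
  have hup_v : upperRamificationSubgroup 𝔓' (L ≃ₐ[F] L) v₀ =
      𝔓'.ramificationSubgroup (L ≃ₐ[F] L) c := by
    rw [upperRamificationSubgroup, hψφ, Nat.ceil_natCast]
  have hup_w : ∀ w, v₀ < w → upperRamificationSubgroup 𝔓' (L ≃ₐ[F] L) w ≤
      𝔓'.ramificationSubgroup (L ≃ₐ[F] L) (c + 1) := by
    intro w hw
    refine 𝔓'.ramificationSubgroup_antitone _ (Nat.add_one_le_iff.mpr (Nat.lt_ceil.mpr ?_))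
    have hmono := herbrandPsi_monotone_holds 𝔓' (L ≃ₐ[F] L) hw.le
    rw [hψφ] at hmono
    refine lt_of_le_of_ne hmono fun heq => hw.ne ?_
    rw [hv₀, heq, herbrandPhi_herbrandPsi_holds]
  have hker : 𝔓'.ramificationSubgroup (L ≃ₐ[F] L) (c + 1) ≤ θ'.ker := by
    intro σ hσ
    have h := not_not.mp hc1
    have hmem : (⟨ι σ, hιmem σ⟩ : H) ∈
        (H ⊓ 𝔓.ramificationSubgroup (L ≃ₐ[K] L) (c + 1)).subgroupOf H := by
      rw [Subgroup.mem_subgroupOf]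
      exact ⟨hιmem σ, (hmemi _ σ).mp hσ⟩
    exact h hmem
  obtain ⟨σ₀, hσ₀c, hσ₀⟩ : ∃ σ₀, σ₀ ∈ 𝔓'.ramificationSubgroup (L ≃ₐ[F] L) c ∧ θ' σ₀ ≠ 1 := by
    obtain ⟨x, hx, hxker⟩ := SetLike.not_le_iff_exists.mp hc
    obtain ⟨σ₀, hσ₀⟩ : ∃ σ₀, ι σ₀ = x := by
      have hxH : (x : L ≃ₐ[K] L) ∈ ι.range := by rw [hιrange]; exact x.2
      exact hxH
    have hxc : (x : L ≃ₐ[K] L) ∈ 𝔓.ramificationSubgroup (L ≃ₐ[K] L) c :=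
      (Subgroup.mem_subgroupOf.mp hx).2
    rw [← hσ₀] at hxc
    have hxeq : (⟨ι σ₀, hιmem σ₀⟩ : H) = x := Subtype.ext hσ₀
    refine ⟨σ₀, (hmemi c σ₀).mpr hxc, fun h1 => hxker ?_⟩
    rw [MonoidHom.mem_ker, ← hxeq, ← hθ', h1]
  have hjump : ∀ w : ℝ, v₀ < w →
      upperRamificationSubgroup (𝔓'.comap (E.integralClosureInclusion (integralClosure R F)))
        (E ≃ₐ[F] E) w ≠
      upperRamificationSubgroup (𝔓'.comap (E.integralClosureInclusion (integralClosure R F)))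
        (E ≃ₐ[F] E) v₀ := by
    intro w hw heq
    rw [hupper, hupper, hup_v] at heq
    have h1 : AlgEquiv.restrictNormalHom E σ₀ ∈
        (𝔓'.ramificationSubgroup (L ≃ₐ[F] L) c).map (AlgEquiv.restrictNormalHom E) :=
      Subgroup.mem_map_of_mem _ hσ₀c
    rw [← heq] at h1
    obtain ⟨τ, hτ, hτσ⟩ := Subgroup.mem_map.mp h1
    have hτker : θ' τ = 1 := hker (hup_w w hw hτ)
    have hq : τ⁻¹ * σ₀ ∈ θ'.ker := by
      rw [← hEfix, ← IntermediateField.restrictNormalHom_ker, MonoidHom.mem_ker, map_mul, map_inv,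
        hτσ, inv_mul_cancel]
    apply hσ₀
    rw [show σ₀ = τ * (τ⁻¹ * σ₀) by group, map_mul, hτker, one_mul]
    exact hq
  -- Hasse–Arf for the abelian extension `E/F` at `𝔓' ∩ E` (with shortcut instances for the
  -- subalgebra `integralClosure R' E`, as above)
  letI algR'T : Algebra (integralClosure R F) (integralClosure (integralClosure R F) E) :=
    (integralClosure (integralClosure R F) E).algebra
  letI smulR'T : SMul (integralClosure R F) (integralClosure (integralClosure R F) E) :=
    algR'T.toSMul
  letI algE : Algebra (integralClosure (integralClosure R F) E)
      (integralClosure (integralClosure R F) L) := integralClosureAlgebra (integralClosure R F) E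
  letI smulE : SMul (integralClosure (integralClosure R F) E)
      (integralClosure (integralClosure R F) L) := algE.toSMul
  haveI : Algebra.IsIntegral (integralClosure (integralClosure R F) E)
      (integralClosure (integralClosure R F) L) := integralClosure_isIntegral (integralClosure R F) E
  haveI : IsScalarTower (integralClosure R F) (integralClosure (integralClosure R F) E)
      (integralClosure (integralClosure R F) L) :=
    integralClosure_isScalarTower_bot (integralClosure R F) E
  haveI : (𝔓'.under (integralClosure (integralClosure R F) E)).IsMaximal :=
    Ideal.IsMaximal.under _ 𝔓'
  haveI : Algebra.IsSeparable
      (integralClosure R F ⧸ (𝔓'.under (integralClosure (integralClosure R F) E)).under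
        (integralClosure R F))
      (integralClosure (integralClosure R F) E ⧸
        𝔓'.under (integralClosure (integralClosure R F) E)) :=
    -- `(𝔓' ∩ S'_E) ∩ R' = 𝔓' ∩ R'` holds definitionally
    isSeparable_residue_bot (integralClosure R F) E 𝔓'
  have h𝔓E : 𝔓'.under (integralClosure (integralClosure R F) E) =
      𝔓'.comap (E.integralClosureInclusion (integralClosure R F)) := rfl
  obtain ⟨n, hn⟩ := hHA (integralClosure R F) F E
    (𝔓'.under (integralClosure (integralClosure R F) E)) hab v₀ (h𝔓E ▸ hjump)
  ------------------------------------------------------------------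
  -- Step 4: `φ'(c) = Σ_{i=1}^{c} |H ∩ G_i| / |H ∩ G_0| = n`
  ------------------------------------------------------------------
  have hphi := herbrandPhi_natCast 𝔓' (L ≃ₐ[F] L) c
  simp only [hcard] at hphi
  rw [hv₀, hphi, ← Finset.sum_div] at hn
  have ha0 : (0 : ℝ) < Nat.card ↥(H ⊓ 𝔓.ramificationSubgroup (L ≃ₐ[K] L) 0) := by
    exact_mod_cast Nat.card_pos
  have hnat : ∑ i ∈ Finset.range c, Nat.card ↥(H ⊓ 𝔓.ramificationSubgroup (L ≃ₐ[K] L) (i + 1)) =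
      n * Nat.card ↥(H ⊓ 𝔓.ramificationSubgroup (L ≃ₐ[K] L) 0) := by
    have h : (∑ i ∈ Finset.range c,
        (Nat.card ↥(H ⊓ 𝔓.ramificationSubgroup (L ≃ₐ[K] L) (i + 1)) : ℝ)) =
        n * Nat.card ↥(H ⊓ 𝔓.ramificationSubgroup (L ≃ₐ[K] L) 0) := by
      rw [eq_div_iff ha0.ne'] at hn
      exact hn.symm
    exact_mod_cast h
  rw [Finset.sum_range_succ', hnat, Ideal.ramificationSubgroup_zero]
  exact ⟨n + 1, by ring⟩

end Main

/-! ### End-to-end: Artin's theorem and the Artin–Katz integrality from Hasse–Arf -/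

section EndToEnd

open scoped NumberField

variable {K : Type u} [Field K] {A : Type v} [Field A] {M : Type w} [AddCommGroup M] [Module A M]

/-- **Artin's theorem `f(τ) ∈ ℕ` for representations of the inertia group at a prime of a number
field** (the named fact `Literature.NumberTheory.GaloisRepresentations.exists_natCast_eq_artinExponent` of `ArtinConductorIntegrality`,
Serre VI §2 Thm 1' with Cor. 1'; Katz 1.9), **from the Hasse–Arf theorem and (in positive
characteristic only) Artin's theorem over finite fields**: the inputs of
`exists_natCast_eq_artinExponent_of` are discharged by `RepTheory.brauer_induction_holds`
(Brauer's theorem, proved in the tree), `card_inf_inertia_dvd_finsum_lowerIndex_holds` (IV §1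
Cor. to Prop. 4, proved) and `card_inf_inertia_dvd_finsum_card_inf_ramificationSubgroup_of_hasseArf`.
Ref: Serre, *Local Fields*, Ch. VI §2, Thm 1' and its proof (p. 103).
[cite: SerreLocalFields1979, Ch. VI §2, Thm 1' (proof)] [cite: Katz1988, Ch. 1, Prop. 1.9 (and its proof)] -/
theorem exists_natCast_eq_artinExponent_of_hasseArf
    (hHA : ∀ (R' K' L' : Type u) [CommRing R'] [Field K'] [Field L'] [Algebra R' K']
      [Algebra R' L'] [Algebra K' L'] [IsScalarTower R' K' L'], hasseArf R' (K := K') (L := L'))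
    (hfin : ∀ {A' : Type v} [Field A'] {M' : Type v} [AddCommGroup M'] [Module A' M'],
      exists_natCast_eq_artinExponent_finiteField (K := K) (A := A') (M := M')) :
    exists_natCast_eq_artinExponent (K := K) (A := A) (M := M) :=
  exists_natCast_eq_artinExponent_of Literature.RepresentationTheory.FiniteGroups.brauer_induction_holds
    (fun R _ _ _ => card_inf_inertia_dvd_finsum_lowerIndex_holds R)
    (fun _ _ _ _ => card_inf_inertia_dvd_finsum_card_inf_ramificationSubgroup_of_hasseArf hHA) hfin

/-- **The corrected Artin–Katz integrality statement from the Hasse–Arf theorem.**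
`Literature.NumberTheory.GaloisRepresentations.GaloisRep.exists_natCast_eq_artinConductorAt_of_hasOpenInertiaKerAt` (`ArtinConductor.lean`:
for a continuous representation of `Γ_K`, `K` a number field, whose restriction to inertia at
`𝔓 ∣ v` factors through a finite discrete quotient, over a field with `(q_v : A) ≠ 0`, the local
Artin conductor `a_𝔓(ρ) = codim M^{I} + Swan` is a natural number — Katz, Prop. 1.9; Serre VI §2
Thm 1') holds granted: the Hasse–Arf theorem (for the finite Galois extensions in the universe
of `K`), and, for `char A > 0` only, Artin's theorem over finite coefficient fields.  Everything
else — Brauer's induction theorem (`RepTheory.brauer_induction_holds`), Herbrand's theorem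
(`herbrand_quotient_holds`), the conductor formula, the integrality of the different exponent,
Serre VI §2 Props. 2–5 and the Brauer-induction bookkeeping — is proved in the tree.
Ref: Katz (1988), Ch. 1, Prop. 1.9; Serre, *Local Fields*, Ch. VI §2, Thm 1' and its proof.
[cite: Katz1988, Ch. 1, Prop. 1.9 (and its proof)] [cite: SerreLocalFields1979, Ch. VI §2, Thm 1' (proof)] -/
theorem GaloisRep.exists_natCast_eq_artinConductorAt_of_hasOpenInertiaKerAt_of_hasseArf
    [TopologicalSpace A] [TopologicalSpace M]
    (hHA : ∀ (R' K' L' : Type u) [CommRing R'] [Field K'] [Field L'] [Algebra R' K']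
      [Algebra R' L'] [Algebra K' L'] [IsScalarTower R' K' L'], hasseArf R' (K := K') (L := L'))
    (hfin : ∀ {A' : Type v} [Field A'] {M' : Type v} [AddCommGroup M'] [Module A' M'],
      exists_natCast_eq_artinExponent_finiteField (K := K) (A := A') (M := M')) :
    GaloisRep.exists_natCast_eq_artinConductorAt_of_hasOpenInertiaKerAt.{u, v, w}
      (K := K) (A := A) (M := M) :=
  GaloisRep.exists_natCast_eq_artinConductorAt_of_hasOpenInertiaKerAt_of_brauer
    (fun R _ _ _ _ hle => herbrand_quotient_holds R (IntermediateField.restrict hle))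
    Literature.RepresentationTheory.FiniteGroups.brauer_induction_holds
    (fun R _ _ _ => card_inf_inertia_dvd_finsum_lowerIndex_holds R)
    (fun _ _ _ _ => card_inf_inertia_dvd_finsum_card_inf_ramificationSubgroup_of_hasseArf hHA) hfin

/-- **Characteristic-`0` coefficients: the corrected Artin–Katz integrality statement from the
Hasse–Arf theorem alone** (no finite-field input; covers
`A = ℂ` — Artin representations — and `A = E_λ`, Katz 1.10).
Ref: Katz (1988), Ch. 1, Prop. 1.9 and Remark 1.10; Serre, *Local Fields*, Ch. VI §2, Thm 1'.
[cite: Katz1988, Ch. 1, Prop. 1.9 (and its proof)] [cite: SerreLocalFields1979, Ch. VI §2, Thm 1' (proof)] -/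
theorem GaloisRep.exists_natCast_eq_artinConductorAt_of_hasOpenInertiaKerAt_of_hasseArf_charZero
    [CharZero A] [TopologicalSpace A] [TopologicalSpace M]
    (hHA : ∀ (R' K' L' : Type u) [CommRing R'] [Field K'] [Field L'] [Algebra R' K']
      [Algebra R' L'] [Algebra K' L'] [IsScalarTower R' K' L'], hasseArf R' (K := K') (L := L')) :
    GaloisRep.exists_natCast_eq_artinConductorAt_of_hasOpenInertiaKerAt.{u, v, w}
      (K := K) (A := A) (M := M) :=
  GaloisRep.exists_natCast_eq_artinConductorAt_of_hasOpenInertiaKerAt_of_brauer_charZero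
    (fun R _ _ _ _ hle => herbrand_quotient_holds R (IntermediateField.restrict hle))
    Literature.RepresentationTheory.FiniteGroups.brauer_induction_holds
    (fun R _ _ _ => card_inf_inertia_dvd_finsum_lowerIndex_holds R)
    (fun _ _ _ _ => card_inf_inertia_dvd_finsum_card_inf_ramificationSubgroup_of_hasseArf hHA)

end EndToEnd

end Literature.NumberTheory.GaloisRepresentations

end
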